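import Literature.Combinatorics.LorentzianPolynomials.LorentzianLogConcave
import Literature.Combinatorics.LorentzianPolynomials.Bivariate
import HarnessLib

/-!
# In at most two variables every Lorentzian polynomial is `1`-Rayleigh (Brändén–Huh 2020, Prop. 2.24, first statement)

Layer `Literature/Combinatorics/LorentzianPolynomials`, namespace `Literature.Combinatorics.LorentzianPolynomials`;
lane `lit-hodgefound` (Track 2 foundations library), seat p16, generation 28 (row g28-#14). Companion of
`RayleighOptimalHigherDegree.lean` (the second statement of Prop. 2.24). "When `n ≤ 2`, all polynomials in `L^d_n` are
`1`-Rayleigh": for `f ∈ L^d_2` and all `α`, `∂^α f` is a bivariate Lorentzian polynomial `g`, and the two Rayleigh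
inequalities of Def. 2.18 with `c = 1` hold for it on `ℝ²_{≥0}` — (i) the mixed one `g ∂_1∂_2 g ≤ ∂_1 g ∂_2 g`, valid for
EVERY homogeneous bivariate polynomial with nonnegative coefficients, and (ii) the pure one `g ∂_1∂_1 g ≤ (∂_1 g)²`, the
log-concavity of `g` (Brändén–Huh: "follows from the concavity of the function `log f` restricted to the line `w_2 = 1`";
here from the Hessian form of log-concavity, `logConcave_of_mem_lorentzian`, `LorentzianLogConcave.lean`). For (i)
Brändén–Huh give an induction on the degree; here instead the one-line identity behind it: for `g = Σ_k a_k w_1^k w_2^{d-k}`,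
`w_1 w_2 (∂_1 g ∂_2 g - g ∂_1∂_2 g) = ½ Σ_{k,l} a_k a_l (k-l)² w_1^{k+l} w_2^{2d-k-l} ≥ 0`
(from `Σ_{k,l} a_k a_l (k-l)(d-l) m_k m_l` symmetrised), giving (i) on the open quadrant and, by continuity, on the
closed one. The one-variable case (`n ≤ 1`) only involves (ii).

## Source (verbatim) — P. Brändén, J. Huh, *Lorentzian polynomials* [BrandenHuh2019] (held `paper:arxiv-1902.03719`)

§2.4 Prop. 2.24: "When `n ≤ 2`, all polynomials in `L^d_n` are `1`-Rayleigh. […] *Proof.* We first show by induction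
that, for any homogeneous bivariate polynomial `f = f(w_1, w_2)` with nonnegative coefficients, we have
`f(w)(∂_1∂_2 f(w)) ≤ (∂_1 f(w))(∂_2 f(w))` for any `w ∈ ℝ²_{≥0}`. […] We next show that, for any bivariate Lorentzian
polynomial `f = f(w_1, w_2)`, we have `f(w)(∂_1∂_1 f(w)) ≤ (∂_1 f(w))(∂_1 f(w))` for any `w ∈ ℝ²_{≥0}`. Since `f` is
homogeneous, it is enough to prove the inequality when `w_2 = 1`. In this case, the inequality follows from the concavity
of the function `log f` restricted to the line `w_2 = 1`. This completes the proof that any bivariate Lorentzian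
polynomial is `1`-Rayleigh."

## What is here

* §1 the bivariate computation: `eval_bivariate'`, `mul_eval_pderiv_zero_bivariate`, `mul_eval_pderiv_one_bivariate`,
  `mul_mul_eval_pderiv_pderiv_bivariate` (Euler-type formulas `w_1 ∂_1 m_k = k m_k`, …), the symmetrisation
  `rayleighSum_two_mul`, and **`eval_mul_eval_pderiv_pderiv_le_bivariate`** ((i) on `ℝ²_{≥0}` for any homogeneous
  `g ∈ ℝ_{≥0}[w_1, w_2]`, boundary by continuity);
* §2 (ii) from log-concavity: `eval_mul_eval_pderiv_pderiv_self_le_of_mem_lorentzian` (any number of variables);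
* §3 **`isCRayleigh_one_of_mem_lorentzian_fin_two`** (Prop. 2.24, first statement, `n = 2`) and
  `isCRayleigh_one_of_mem_lorentzian_of_subsingleton` (`n ≤ 1`).

Theorems only; no `sorry`, no named fact (net debt 0).

## References

* [BrandenHuh2019] P. Brändén, J. Huh, *Lorentzian polynomials*, Ann. of Math. (2) 192 (2020) 821–891, arXiv:1902.03719 —
  §2.4 Prop. 2.24 (first statement and its proof); Def. 2.18; §2.5 Thm. 2.30.
-/

noncomputable section

open MvPolynomial Finsupp Finset
open Literature.LinearAlgebra.QuadraticForm

namespace Literature.Combinatorics.LorentzianPolynomials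

/-! ## §1 Homogeneous bivariate polynomials with nonnegative coefficients: `g ∂_1∂_2 g ≤ ∂_1 g ∂_2 g` -/

section Bivariate

/-- `Σ_k a_k w_0^k w_1^{d-k}` evaluated. [cite: BrandenHuh2019, §2.4 proof of Prop. 2.24 ("`f = c_1 w_1^d + c_2 w_2^d + w_1 w_2 g`")] -/
theorem eval_bivariate' (d : ℕ) (a : ℕ → ℝ) (w : Fin 2 → ℝ) :
    eval w (bivariate d a) = ∑ k ∈ range (d + 1), a k * (w 0 ^ k * w 1 ^ (d - k)) := by
  rw [bivariate_eq_sum, map_sum]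
  refine Finset.sum_congr rfl fun k _ ↦ ?_
  simp only [map_mul, map_pow, eval_C, eval_X]
  ring

/-- `w_0 · ∂_0 (Σ_k a_k w_0^k w_1^{d-k}) = Σ_k k a_k w_0^k w_1^{d-k}` (Euler in the first variable).
[cite: BrandenHuh2019, §2.4 proof of Prop. 2.24 ("`(1 + w_i ∂_i) h`")] -/
theorem mul_eval_pderiv_zero_bivariate (d : ℕ) (a : ℕ → ℝ) (w : Fin 2 → ℝ) :
    w 0 * eval w (pderiv 0 (bivariate d a)) = ∑ k ∈ range (d + 1), (k : ℝ) * a k * (w 0 ^ k * w 1 ^ (d - k)) := by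
  rw [bivariate_eq_sum, map_sum, map_sum, Finset.mul_sum]
  refine Finset.sum_congr rfl fun k _ ↦ ?_
  simp only [pderiv_mul, pderiv_C, pderiv_pow, pderiv_X_self, pderiv_X_of_ne (one_ne_zero : (1 : Fin 2) ≠ 0), zero_mul,
    zero_add, mul_zero, add_zero, mul_one, map_mul, map_pow, map_natCast, eval_C, eval_X]
  rcases Nat.eq_zero_or_pos k with rfl | hk
  · simp
  · obtain ⟨k', rfl⟩ : ∃ k', k = k' + 1 := ⟨k - 1, by omega⟩
    rw [Nat.add_sub_cancel, pow_succ]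
    push_cast
    ring

/-- `w_1 · ∂_1 (Σ_k a_k w_0^k w_1^{d-k}) = Σ_k (d-k) a_k w_0^k w_1^{d-k}`. [cite: BrandenHuh2019, §2.4 proof of Prop. 2.24] -/
theorem mul_eval_pderiv_one_bivariate (d : ℕ) (a : ℕ → ℝ) (w : Fin 2 → ℝ) :
    w 1 * eval w (pderiv 1 (bivariate d a)) =
      ∑ k ∈ range (d + 1), ((d : ℝ) - k) * a k * (w 0 ^ k * w 1 ^ (d - k)) := by
  rw [bivariate_eq_sum, map_sum, map_sum, Finset.mul_sum]
  refine Finset.sum_congr rfl fun k hk ↦ ?_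
  have hkd : k ≤ d := by have := Finset.mem_range.1 hk; omega
  simp only [pderiv_mul, pderiv_C, pderiv_pow, pderiv_X_self, pderiv_X_of_ne (zero_ne_one : (0 : Fin 2) ≠ 1), zero_mul,
    zero_add, mul_zero, mul_one, map_mul, map_pow, map_natCast, eval_C, eval_X]
  rcases Nat.eq_zero_or_pos (d - k) with h0 | hpos
  · rw [h0]
    have : (d : ℝ) - k = 0 := by
      have : d = k := by omega
      rw [this, sub_self]
    rw [this]
    simp
  · obtain ⟨e, he⟩ : ∃ e, d - k = e + 1 := ⟨d - k - 1, by omega⟩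
    rw [he, Nat.add_sub_cancel, pow_succ]
    have : (d : ℝ) - k = ((e + 1 : ℕ) : ℝ) := by
      rw [show d = k + (e + 1) by omega]; push_cast; ring
    rw [this]
    push_cast
    ring

/-- `w_0 w_1 · ∂_0∂_1 (Σ_k a_k w_0^k w_1^{d-k}) = Σ_k k(d-k) a_k w_0^k w_1^{d-k}`. [cite: BrandenHuh2019, §2.4 proof of
Prop. 2.24] -/
theorem mul_mul_eval_pderiv_pderiv_bivariate (d : ℕ) (a : ℕ → ℝ) (w : Fin 2 → ℝ) :
    w 0 * w 1 * eval w (pderiv 0 (pderiv 1 (bivariate d a))) =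
      ∑ k ∈ range (d + 1), (k : ℝ) * ((d : ℝ) - k) * a k * (w 0 ^ k * w 1 ^ (d - k)) := by
  rw [bivariate_eq_sum, map_sum, map_sum, map_sum, Finset.mul_sum]
  refine Finset.sum_congr rfl fun k hk ↦ ?_
  have hkd : k ≤ d := by have := Finset.mem_range.1 hk; omega
  simp only [pderiv_mul, pderiv_C, pderiv_pow, pderiv_X_self, pderiv_X_of_ne (zero_ne_one : (0 : Fin 2) ≠ 1),
    pderiv_X_of_ne (one_ne_zero : (1 : Fin 2) ≠ 0), Derivation.map_natCast, zero_mul, zero_add, mul_zero, add_zero,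
    mul_one, map_mul, map_pow, map_natCast, eval_C, eval_X]
  rcases Nat.eq_zero_or_pos k with rfl | hk0
  · simp
  rcases Nat.eq_zero_or_pos (d - k) with h0 | hpos
  · rw [h0]
    have : (d : ℝ) - k = 0 := by
      have : d = k := by omega
      rw [this, sub_self]
    rw [this]
    simp
  · obtain ⟨k', rfl⟩ : ∃ k', k = k' + 1 := ⟨k - 1, by omega⟩
    obtain ⟨e, he⟩ : ∃ e, d - (k' + 1) = e + 1 := ⟨d - (k' + 1) - 1, by omega⟩
    rw [he, Nat.add_sub_cancel, Nat.add_sub_cancel, pow_succ, pow_succ]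
    have : (d : ℝ) - ((k' + 1 : ℕ) : ℝ) = ((e + 1 : ℕ) : ℝ) := by
      rw [show d = (k' + 1) + (e + 1) by omega]; push_cast; ring
    rw [this]
    push_cast
    ring

/-- **The symmetrisation identity**: with `m_k = w_0^k w_1^{d-k}`,
`2 Σ_{k,l} a_k a_l m_k m_l (k-l)(d-l) = Σ_{k,l} a_k a_l m_k m_l (k-l)²`. [cite: BrandenHuh2019, §2.4 proof of Prop. 2.24
(the induction for the bivariate inequality, replaced by this identity)] -/
theorem rayleighSum_two_mul (d : ℕ) (a m : ℕ → ℝ) :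
    2 * ∑ k ∈ range (d + 1), ∑ l ∈ range (d + 1), a k * a l * (m k * m l) * (((k : ℝ) - l) * ((d : ℝ) - l)) =
      ∑ k ∈ range (d + 1), ∑ l ∈ range (d + 1), a k * a l * (m k * m l) * ((k : ℝ) - l) ^ 2 := by
  have hcomm : ∑ k ∈ range (d + 1), ∑ l ∈ range (d + 1), a k * a l * (m k * m l) * (((k : ℝ) - l) * ((d : ℝ) - l)) =
      ∑ k ∈ range (d + 1), ∑ l ∈ range (d + 1), a l * a k * (m l * m k) * (((l : ℝ) - k) * ((d : ℝ) - k)) :=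
    Finset.sum_comm
  have h2 : 2 * ∑ k ∈ range (d + 1), ∑ l ∈ range (d + 1), a k * a l * (m k * m l) * (((k : ℝ) - l) * ((d : ℝ) - l)) =
      (∑ k ∈ range (d + 1), ∑ l ∈ range (d + 1), a k * a l * (m k * m l) * (((k : ℝ) - l) * ((d : ℝ) - l))) +
        ∑ k ∈ range (d + 1), ∑ l ∈ range (d + 1), a l * a k * (m l * m k) * (((l : ℝ) - k) * ((d : ℝ) - k)) := by
    rw [← hcomm, two_mul]
  rw [h2, ← Finset.sum_add_distrib]
  refine Finset.sum_congr rfl fun k _ ↦ ?_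
  rw [← Finset.sum_add_distrib]
  exact Finset.sum_congr rfl fun l _ ↦ by ring

/-- **(i) on the open quadrant, multiplied out**: for `g = Σ_k a_k w_0^k w_1^{d-k}` with `a_k ≥ 0` and `w ∈ ℝ²_{≥0}`,
`w_0 w_1 · (∂_0 g ∂_1 g - g ∂_0∂_1 g)(w) ≥ 0`. [cite: BrandenHuh2019, §2.4 proof of Prop. 2.24] -/
theorem mul_mul_rayleighDiff_bivariate_nonneg {d : ℕ} {a : ℕ → ℝ} (ha : ∀ k ≤ d, 0 ≤ a k) {w : Fin 2 → ℝ}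
    (hw : ∀ k, 0 ≤ w k) :
    0 ≤ w 0 * w 1 * (eval w (pderiv 0 (bivariate d a)) * eval w (pderiv 1 (bivariate d a)) -
      eval w (bivariate d a) * eval w (pderiv 0 (pderiv 1 (bivariate d a)))) := by
  set m : ℕ → ℝ := fun k ↦ w 0 ^ k * w 1 ^ (d - k) with hm
  have hkey : w 0 * w 1 * (eval w (pderiv 0 (bivariate d a)) * eval w (pderiv 1 (bivariate d a)) -
      eval w (bivariate d a) * eval w (pderiv 0 (pderiv 1 (bivariate d a)))) =
      ∑ k ∈ range (d + 1), ∑ l ∈ range (d + 1), a k * a l * (m k * m l) * (((k : ℝ) - l) * ((d : ℝ) - l)) := by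
    have h : w 0 * w 1 * (eval w (pderiv 0 (bivariate d a)) * eval w (pderiv 1 (bivariate d a)) -
        eval w (bivariate d a) * eval w (pderiv 0 (pderiv 1 (bivariate d a)))) =
        (w 0 * eval w (pderiv 0 (bivariate d a))) * (w 1 * eval w (pderiv 1 (bivariate d a))) -
          eval w (bivariate d a) * (w 0 * w 1 * eval w (pderiv 0 (pderiv 1 (bivariate d a)))) := by ring
    rw [h, mul_eval_pderiv_zero_bivariate, mul_eval_pderiv_one_bivariate, mul_mul_eval_pderiv_pderiv_bivariate,
      eval_bivariate', Finset.sum_mul_sum, Finset.sum_mul_sum, ← Finset.sum_sub_distrib]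
    refine Finset.sum_congr rfl fun k _ ↦ ?_
    rw [← Finset.sum_sub_distrib]
    exact Finset.sum_congr rfl fun l _ ↦ by simp only [hm]; ring
  have h2 := rayleighSum_two_mul d a m
  rw [hkey]
  have hnn : 0 ≤ ∑ k ∈ range (d + 1), ∑ l ∈ range (d + 1), a k * a l * (m k * m l) * ((k : ℝ) - l) ^ 2 :=
    Finset.sum_nonneg fun k hk ↦ Finset.sum_nonneg fun l hl ↦ mul_nonneg (mul_nonneg
      (mul_nonneg (ha k (by have := Finset.mem_range.1 hk; omega)) (ha l (by have := Finset.mem_range.1 hl; omega)))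
      (mul_nonneg (mul_nonneg (pow_nonneg (hw 0) _) (pow_nonneg (hw 1) _))
        (mul_nonneg (pow_nonneg (hw 0) _) (pow_nonneg (hw 1) _)))) (sq_nonneg _)
  linarith

/-- **Brändén–Huh's bivariate inequality (i)**: for any homogeneous `g ∈ ℝ_{≥0}[w_0, w_1]` and `w ∈ ℝ²_{≥0}`,
`g(w) ∂_0∂_1 g(w) ≤ ∂_0 g(w) ∂_1 g(w)` (on the open quadrant from `mul_mul_rayleighDiff_bivariate_nonneg`, on the
boundary by continuity along `w + ε𝟙`). [cite: BrandenHuh2019, §2.4 proof of Prop. 2.24 ("for any homogeneous bivariate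
polynomial `f` with nonnegative coefficients, we have `f(w)(∂_1∂_2 f(w)) ≤ (∂_1 f(w))(∂_2 f(w))` for any `w ∈ ℝ²_{≥0}`")] -/
theorem eval_mul_eval_pderiv_pderiv_le_bivariate {g : MvPolynomial (Fin 2) ℝ} {d : ℕ} (hg : g.IsHomogeneous d)
    (hnn : ∀ β, 0 ≤ coeff β g) {w : Fin 2 → ℝ} (hw : ∀ k, 0 ≤ w k) :
    eval w g * eval w (pderiv 0 (pderiv 1 g)) ≤ eval w (pderiv 0 g) * eval w (pderiv 1 g) := by
  have hga := eq_bivariate_of_isHomogeneous hg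
  set a : ℕ → ℝ := fun k ↦ coeff (bideg k (d - k)) g with ha_def
  have ha : ∀ k ≤ d, 0 ≤ a k := fun k _ ↦ hnn _
  -- the open quadrant
  have hopen : ∀ v : Fin 2 → ℝ, (∀ k, 0 < v k) →
      eval v g * eval v (pderiv 0 (pderiv 1 g)) ≤ eval v (pderiv 0 g) * eval v (pderiv 1 g) := by
    intro v hv
    have h := mul_mul_rayleighDiff_bivariate_nonneg (d := d) ha (w := v) fun k ↦ (hv k).le
    rw [← hga] at h
    have hpos : 0 < v 0 * v 1 := mul_pos (hv 0) (hv 1)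
    have := nonneg_of_mul_nonneg_right (by rwa [mul_comm] at h) hpos
    linarith
  -- continuity along `w + ε𝟙`
  let L : ℝ → ℝ := fun ε ↦ eval (fun k ↦ w k + ε) g * eval (fun k ↦ w k + ε) (pderiv 0 (pderiv 1 g))
  let R : ℝ → ℝ := fun ε ↦ eval (fun k ↦ w k + ε) (pderiv 0 g) * eval (fun k ↦ w k + ε) (pderiv 1 g)
  have hpath : Continuous fun ε : ℝ ↦ (fun k : Fin 2 ↦ w k + ε) := continuous_pi fun k ↦ continuous_const.add continuous_id
  have hL : Continuous L :=
    ((MvPolynomial.continuous_eval g).comp hpath).mul ((MvPolynomial.continuous_eval (pderiv 0 (pderiv 1 g))).comp hpath)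
  have hR : Continuous R :=
    ((MvPolynomial.continuous_eval (pderiv 0 g)).comp hpath).mul ((MvPolynomial.continuous_eval (pderiv 1 g)).comp hpath)
  have hle : ∀ ε, 0 < ε → L ε ≤ R ε := fun ε hε ↦ hopen (fun k ↦ w k + ε) fun k ↦ by linarith [hw k]
  have hev : ∀ᶠ ε in nhdsWithin (0 : ℝ) (Set.Ioi 0), L ε ≤ R ε := eventually_nhdsWithin_of_forall fun ε hε ↦ hle ε hε
  have hLt : Filter.Tendsto L (nhdsWithin 0 (Set.Ioi 0)) (nhds (L 0)) := (hL.tendsto 0).mono_left nhdsWithin_le_nhds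
  have hRt : Filter.Tendsto R (nhdsWithin 0 (Set.Ioi 0)) (nhds (R 0)) := (hR.tendsto 0).mono_left nhdsWithin_le_nhds
  have key : L 0 ≤ R 0 := le_of_tendsto_of_tendsto hLt hRt hev
  simpa [L, R] using key

end Bivariate

/-! ## §2 The pure inequality `g ∂_i∂_i g ≤ (∂_i g)²` from log-concavity -/

section Pure

variable {σ : Type*} [Fintype σ] [DecidableEq σ]

/-- **(ii)**: for `g ∈ L^d_n`, `w ∈ ℝ^n_{≥0}` and any `i`: `g(w) ∂_i∂_i g(w) ≤ (∂_i g(w))²` — the Hessian form of the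
log-concavity of `g` (`logConcave_of_mem_lorentzian` at `x = e_i`). [cite: BrandenHuh2019, §2.4 proof of Prop. 2.24
("follows from the concavity of the function `log f`"); §2.5 Thm. 2.30] -/
theorem eval_mul_eval_pderiv_pderiv_self_le_of_mem_lorentzian {d : ℕ} {g : MvPolynomial σ ℝ} (hg : g ∈ lorentzian σ d)
    {w : σ → ℝ} (hw : ∀ k, 0 ≤ w k) (i : σ) :
    eval w g * eval w (pderiv i (pderiv i g)) ≤ eval w (pderiv i g) * eval w (pderiv i g) := by
  have h := logConcave_of_mem_lorentzian hg hw (Pi.single i 1)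
  rw [Matrix.toBilin'_single, hessianAt_apply] at h
  have hs : ∑ k, (Pi.single i (1 : ℝ) : σ → ℝ) k * eval w (pderiv k g) = eval w (pderiv i g) := by
    rw [Finset.sum_eq_single i (fun k _ hk ↦ by rw [Pi.single_eq_of_ne hk, zero_mul]) (fun h ↦ (h (Finset.mem_univ i)).elim),
      Pi.single_eq_same, one_mul]
  rw [hs, sq] at h
  exact h

end Pure

/-! ## §3 Proposition 2.24, first statement -/

section Main

/-- The Rayleigh inequality of Def. 2.18 with `c = 1` for `g = ∂^α f`, `f ∈ L^d_2`, in the mixed direction `(0,1)`.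
[cite: BrandenHuh2019, §2.4 proof of Prop. 2.24] -/
theorem eval_mul_eval_pderiv_pderiv_le_of_mem_lorentzian_fin_two {d : ℕ} {g : MvPolynomial (Fin 2) ℝ}
    (hg : g ∈ lorentzian (Fin 2) d) {w : Fin 2 → ℝ} (hw : ∀ k, 0 ≤ w k) (i j : Fin 2) :
    eval w g * eval w (pderiv i (pderiv j g)) ≤ eval w (pderiv i g) * eval w (pderiv j g) := by
  by_cases hij : i = j
  · subst hij
    exact eval_mul_eval_pderiv_pderiv_self_le_of_mem_lorentzian hg hw i
  · have hhom := isHomogeneous_of_mem_lorentzian hg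
    have hnn := coeff_nonneg_of_mem_lorentzian hg
    -- `{i, j} = {0, 1}`
    rcases Fin.exists_fin_two.1 ⟨i, rfl⟩ with hi | hi <;> rcases Fin.exists_fin_two.1 ⟨j, rfl⟩ with hj | hj
    · exact absurd (hi.trans hj.symm) hij
    · subst hi; subst hj
      exact eval_mul_eval_pderiv_pderiv_le_bivariate hhom hnn hw
    · subst hi; subst hj
      rw [pderiv_pderiv_comm, mul_comm (eval w (pderiv 1 g))]
      exact eval_mul_eval_pderiv_pderiv_le_bivariate hhom hnn hw
    · exact absurd (hi.trans hj.symm) hij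

/-- **Brändén–Huh, Prop. 2.24, first statement (`n = 2`): every polynomial of `L^d_2` is `1`-Rayleigh.**
[cite: BrandenHuh2019, §2.4 Prop. 2.24 ("When `n ≤ 2`, all polynomials in `L^d_n` are `1`-Rayleigh")] -/
theorem isCRayleigh_one_of_mem_lorentzian_fin_two {d : ℕ} {f : MvPolynomial (Fin 2) ℝ} (hf : f ∈ lorentzian (Fin 2) d) :
    IsCRayleigh 1 f := by
  refine ⟨coeff_nonneg_of_mem_lorentzian hf, fun α i j w hw ↦ ?_⟩
  rw [one_mul, iterPderiv_add_single (α + Finsupp.single i 1) j f, iterPderiv_add_single α i f,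
    iterPderiv_add_single α j f, pderiv_pderiv_comm j i]
  rcases Nat.lt_or_ge d α.degree with hlt | hle
  · rw [iterPderiv_eq_zero_of_lt (isHomogeneous_of_mem_lorentzian hf) hlt]
    simp
  · obtain ⟨e, rfl⟩ : ∃ e, d = e + α.degree := ⟨d - α.degree, by omega⟩
    exact eval_mul_eval_pderiv_pderiv_le_of_mem_lorentzian_fin_two (iterPderiv_mem_lorentzian hf) hw i j

/-- **Prop. 2.24, first statement, `n ≤ 1`**: on at most one variable every Lorentzian polynomial is `1`-Rayleigh (only
the pure inequality (ii) occurs). [cite: BrandenHuh2019, §2.4 Prop. 2.24 ("When `n ≤ 2`")] -/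
theorem isCRayleigh_one_of_mem_lorentzian_of_subsingleton {σ : Type*} [Fintype σ] [DecidableEq σ] [Subsingleton σ]
    {d : ℕ} {f : MvPolynomial σ ℝ} (hf : f ∈ lorentzian σ d) : IsCRayleigh 1 f := by
  refine ⟨coeff_nonneg_of_mem_lorentzian hf, fun α i j w hw ↦ ?_⟩
  have hij : j = i := Subsingleton.elim j i
  subst hij
  rw [one_mul, iterPderiv_add_single (α + Finsupp.single j 1) j f, iterPderiv_add_single α j f]
  rcases Nat.lt_or_ge d α.degree with hlt | hle
  · rw [iterPderiv_eq_zero_of_lt (isHomogeneous_of_mem_lorentzian hf) hlt]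
    simp
  · obtain ⟨e, rfl⟩ : ∃ e, d = e + α.degree := ⟨d - α.degree, by omega⟩
    exact eval_mul_eval_pderiv_pderiv_self_le_of_mem_lorentzian (iterPderiv_mem_lorentzian hf) hw j

end Main

end Literature.Combinatorics.LorentzianPolynomials

end
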